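import Summits.BirchSwinnertonDyer.BirchSwinnertonDyer.Theorems.SylvesterTwoHeegnerIndexCMHalfPrep
import HarnessLib

/-!
# (S2) of leaf (L1) at `p ≡ 7 (mod 9)`, crux `UpperOffV0HSYPlus` (stmt-BirchSwinnertonDyer-19804):
# THE BOTTOM `χ_B`-COMPONENT OF THE HALVED SYSTEM is `[𝒢₀ : H] • Y′ + (3-torsion)` — #G's twin for the half index set

Skeleton of record VARIANT M (`Cruxes/UpperOffV0HSYPlus/Lines/coupled_variantM.lean` 406ca288e244d392), stub
`stub_layerL1Seven`; planner D507 (4); k7t-c2 g25 finding (STATUS 2026-08-28T23:40Z).  With #G's data (frame,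
`ρ`, embedded `K[9p]`, `N₀`, `H`, lifts `T`, product representatives `t (q, h) = T(q̃)·T(h)` of `Γ_K/N₀`, HSY's
`y₁, T₃, Y₁`) and the involution datum (`s ∈ H` with `s·y₁ = y₁`, a half `H′` of `H` — memo two §67.2 (W2-b) at
`n = 1`, an INPUT displayed as binders), for every `Y′ ∈ E_p(K)` with `2 • Y′ = Y₁` (the half-trace point of the
companion file `…CMHalfBottom`):

`half_bottom_chiComponent_eq_toGeomPoints`:
`ψ_B (Σ_{(q,h) ∈ (𝒢₀⧸H) × H′} ρ_{t(q,h)}(t(q,h) • κ⁻¹ ι_pt y₁)) = ι([𝒢₀ : H] • Y′ + T₀′)` with `3 T₀′ = 0` — the full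
`χ_B`-sum is twice the half sum (`T(hs) • P₁ = T(h) • P₁`), the full sum is `ι([𝒢₀:H] • Y₁ + T₀)` (#G
`bottom_chiComponent_eq_toGeomPoints`), and `ψ_B(E₉(K̄)^{N₀})` has no `2`-torsion (prep file).  Hence, by #G's
`kolyvaginClass_eq_kummerClassOfPoint_of_eq` (`[𝒢₀ : H]` odd, `odd_card_quotient_stabilizer`), the bottom class of
the halved system at level `2` is `kummerClassOfPoint Y′` — the class against which #23/#24 state the FLIP at 7.

Theorems only (no `def`, no `sorry`, no new `Prop`); the involution datum is DISPLAYED; nothing asserted on 19804;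
no stub closed; X12.CMAtTwo NOT proved; BSD is not proved by any of this.
`--supports stmt-BirchSwinnertonDyer-19804 --as helper`.
-/

set_option linter.dupNamespace false
set_option autoImplicit false

noncomputable section

open scoped Classical Pointwise

namespace Summit.BirchSwinnertonDyer.BirchSwinnertonDyer.Theorems.SylvesterTwoCMHalf

open WeierstrassCurve WeierstrassCurve.Affine.Point Field NumberField IsDedekindDomain Finset
open Literature.NumberTheory.EllipticCurves Literature.NumberTheory.GaloisRepresentations
  Literature.NumberTheory.EllipticCurves.ModularForms
  Literature.NumberTheory.EllipticCurves.HuShuYin2019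
  Literature.NumberTheory.EllipticCurves.KolyvaginCocycle
  Summit.BirchSwinnertonDyer.BirchSwinnertonDyer.Theorems.SylvesterTwoCMData
  Summit.BirchSwinnertonDyer.BirchSwinnertonDyer.Theorems.SylvesterTwoCMFlip

variable {K : Type} [Field K] [NumberField K]

/-! ## §1. The bottom `χ_B`-component of the HALVED system is `[𝒢₀ : H] • Y′ + (3-torsion)` -/

/-- **(G-a) for the HALF index set.**  With #G's data (frame, `ρ`, embedded `K[9p]`, `N₀`, `H`, lifts `T`,
product representatives `t (q, h) = T(q̃)·T(h)` of `Γ_K/N₀`, HSY's `y₁, T₃, Y₁`) and the involution datum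
(`s ∈ H` with `s·y₁ = y₁`, a half `H′` of `H`), for every `Y′ ∈ E_p(K)` with `2 • Y′ = Y₁`:
`ψ_B (Σ_{(q,h) ∈ (𝒢₀⧸H) × H′} ρ_{t(q,h)}(t(q,h) • κ⁻¹ ι_pt y₁)) = ι([𝒢₀ : H] • Y′ + T₀′)` with `3 T₀′ = 0` — the
full `χ_B`-sum is twice the half sum (`T(hs) • P₁ = T(h) • P₁`), the full sum is `ι([𝒢₀:H] • Y₁ + T₀)` (#G), and
`ψ_B(E₉(K̄)^{N₀})` has no `2`-torsion.  Hence (#G `kolyvaginClass_eq_kummerClassOfPoint_of_eq`, `[𝒢₀ : H]` odd)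
the bottom class of the halved system is `kummerClassOfPoint Y′`.
[cite: HuShuYin2019, §4.1, §2 Prop. 2.4, §3 p. 8] [cite: GrossLMS1991, §12 (y_χ), §4 (4.1)–(4.2)] -/
theorem half_bottom_chiComponent_eq_toGeomPoints {ω : K} (hω : ω ^ 2 + ω + 1 = 0) (h2 : Module.finrank ℚ K = 2)
    (ι : K →+* ℂ) {p : ℕ} (hp0 : p ≠ 0) (hp2 : Odd p)
    (κ : geomPoints ((cubeSumCurve 9).baseChange K) ≃+
      geomPoints ((⟨0, 0, 1, 0, -1⟩ : WeierstrassCurve ℚ).baseChange K))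
    (hκG : ∀ (g : absoluteGaloisGroup K) (P : geomPoints ((cubeSumCurve 9).baseChange K)),
      κ (g • P) = g • κ P)
    {vB : AlgebraicClosure K} (hvBc : vB ^ 3 = algebraMap ℚ (AlgebraicClosure K) ((p : ℚ) / 9))
    (hvB : vB ≠ 0)
    (hvB3 : ∀ g : absoluteGaloisGroup K,
      ((show AlgebraicClosure K ≃ₐ[K] AlgebraicClosure K from g) vB) ^ 3 = vB ^ 3)
    {ψB : geomPoints ((cubeSumCurve 9).baseChange K) ≃+ geomPoints ((cubeSumCurve (p : ℚ)).baseChange K)}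
    (hψB : ∀ {x y : AlgebraicClosure K}
      (h : (((cubeSumCurve 9).baseChange K).baseChange (AlgebraicClosure K)).toAffine.Nonsingular x y),
      ∃ h', ψB (Affine.Point.some x y h) = Affine.Point.some (vB ^ 2 * x) (vB ^ 3 * y) h')
    {ρ : absoluteGaloisGroup K →
      geomPoints ((cubeSumCurve 9).baseChange K) ≃+ geomPoints ((cubeSumCurve 9).baseChange K)}
    (hρ : ∀ (g : absoluteGaloisGroup K) {x y : AlgebraicClosure K}
        (h : (((cubeSumCurve 9).baseChange K).baseChange (AlgebraicClosure K)).toAffine.Nonsingular x y),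
        ∃ h', ρ g (Affine.Point.some x y h) =
          Affine.Point.some (((show AlgebraicClosure K ≃ₐ[K] AlgebraicClosure K from g) vB / vB) ^ 2 * x)
            y h')
    (hlawB : ∀ (g : absoluteGaloisGroup K) (P : geomPoints ((cubeSumCurve 9).baseChange K)),
        g • ψB P = ψB (ρ g (g • P)))
    (hρcomm : ∀ (g h : absoluteGaloisGroup K) (P : geomPoints ((cubeSumCurve 9).baseChange K)),
        h • ρ g P = ρ g (h • P))
    (emb : ringClassField K ι (9 * p) →+* AlgebraicClosure K)
    (hemb : ∀ k : K, emb (algebraMap K (ringClassField K ι (9 * p)) k) = algebraMap K (AlgebraicClosure K) k)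
    (ιpt : letI : DecidableEq (ringClassField K ι (9 * p)) := fun a b ↦ Classical.propDecidable (a = b)
      ((⟨0, 0, 1, 0, -1⟩ : WeierstrassCurve ℚ).baseChange (ringClassField K ι (9 * p))).toAffine.Point →+
        geomPoints (((⟨0, 0, 1, 0, -1⟩ : WeierstrassCurve ℚ)).baseChange K))
    (hιpt : ∀ Q, ιpt Q = Affine.Point.map (W' := (⟨0, 0, 1, 0, -1⟩ : WeierstrassCurve ℚ)) emb.toRatAlgHom Q)
    (N₀ : Subgroup (absoluteGaloisGroup K))
    (hN₀ : ∀ g : absoluteGaloisGroup K, g ∈ N₀ ↔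
      ∀ x : ringClassField K ι (9 * p), (show AlgebraicClosure K ≃ₐ[K] AlgebraicClosure K from g) (emb x) = emb x)
    {c₃ cp : ringClassField K ι (9 * p)} (hc₃ : c₃ ^ 3 = 3) (hcp : cp ^ 3 = (p : ringClassField K ι (9 * p)))
    (H : Subgroup (ringClassField K ι (9 * p) ≃ₐ[K] ringClassField K ι (9 * p)))
    (hH : ∀ σ, σ ∈ H ↔ σ c₃ = c₃ ∧ σ cp = cp)
    [Fintype ((ringClassField K ι (9 * p) ≃ₐ[K] ringClassField K ι (9 * p)) ⧸ H)] [Fintype H]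
    (T : (ringClassField K ι (9 * p) ≃ₐ[K] ringClassField K ι (9 * p)) → absoluteGaloisGroup K)
    (hT : ∀ σ (x : ringClassField K ι (9 * p)),
      (show AlgebraicClosure K ≃ₐ[K] AlgebraicClosure K from T σ) (emb x) = emb (σ x))
    (t : ((ringClassField K ι (9 * p) ≃ₐ[K] ringClassField K ι (9 * p)) ⧸ H) × H → absoluteGaloisGroup K)
    (ht' : ∀ q h, t (q, h) = T (Quotient.out q) * T (h : _))
    (ht : Function.Bijective fun i ↦ (t i : absoluteGaloisGroup K ⧸ N₀))
    -- the involution datum: `s ∈ H`, `s · y₁ = y₁`, a half `H′` of `H`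
    (s : H) (H' : Finset H) (hH' : ∀ h : H, Xor (h ∈ H') (h * s ∈ H'))
    (y₁ T₃ : ((⟨0, 0, 1, 0, -1⟩ : WeierstrassCurve ℚ).baseChange (ringClassField K ι (9 * p))).toAffine.Point)
    (hsy : pointGalHom (⟨0, 0, 1, 0, -1⟩ : WeierstrassCurve ℚ) (ringClassField K ι (9 * p))
      ((s : _ ≃ₐ[K] _).restrictScalars ℚ) y₁ = y₁)
    (hT₃ : 3 • T₃ = 0) (Y₁ Y' : ((cubeSumCurve (p : ℚ)).baseChange K).toAffine.Point)
    (hY₁ : toGeomPoints ((cubeSumCurve (p : ℚ)).baseChange K) Y₁ =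
      ψB (κ.symm (ιpt ((∑ h : H, pointGalHom (⟨0, 0, 1, 0, -1⟩ : WeierstrassCurve ℚ)
        (ringClassField K ι (9 * p)) ((h : _ ≃ₐ[K] _).restrictScalars ℚ) y₁) - T₃))))
    (h2Y' : (2 : ℕ) • Y' = Y₁) :
    ∃ T₀ : ((cubeSumCurve (p : ℚ)).baseChange K).toAffine.Point, (3 : ℤ) • T₀ = 0 ∧
      ψB (∑ i : ((ringClassField K ι (9 * p) ≃ₐ[K] ringClassField K ι (9 * p)) ⧸ H) × H',
          ρ (t (i.1, (i.2 : H))) (t (i.1, (i.2 : H)) • κ.symm (ιpt y₁))) =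
        toGeomPoints ((cubeSumCurve (p : ℚ)).baseChange K)
          ((Fintype.card ((ringClassField K ι (9 * p) ≃ₐ[K] ringClassField K ι (9 * p)) ⧸ H) : ℤ) • Y' + T₀) := by
  -- ### the full sum (#G)
  obtain ⟨T₀, hT₀, hfull⟩ := bottom_chiComponent_eq_toGeomPoints hω ι hp0 κ hκG hvBc hvB hvB3 hρ hlawB hρcomm emb
    ιpt hιpt N₀ hN₀ hc₃ hcp H hH T hT t ht' ht y₁ T₃ hT₃ Y₁ hY₁
  -- ### abbreviations
  have hκs : ∀ (g : absoluteGaloisGroup K) (Q : geomPoints ((⟨0, 0, 1, 0, -1⟩ : WeierstrassCurve ℚ).baseChange K)),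
      κ.symm (g • Q) = g • κ.symm Q := fun g Q ↦
    κ.injective (by rw [hκG, κ.apply_symm_apply, κ.apply_symm_apply])
  set P₁ := κ.symm (ιpt y₁) with hP₁
  have hNv := apply_vB_eq_of_mem_fixer hω ι hp0 hvBc emb N₀ hN₀ hc₃ hcp
  have hc₃0 : c₃ ≠ 0 := fun h ↦ by rw [h] at hc₃; norm_num at hc₃
  have hcp0 : cp ≠ 0 := fun h ↦ by
    rw [h, zero_pow three_ne_zero] at hcp; exact hp0 (by exact_mod_cast hcp.symm)
  have hw3 : (emb cp / emb c₃ ^ 2) ^ 3 = vB ^ 3 := by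
    rw [hvBc, div_pow, ← pow_mul, ← map_pow, ← map_pow, hcp, show 2 * 3 = 3 * 2 from rfl, pow_mul, hc₃,
      map_natCast, map_pow, map_ofNat, eq_ratCast]
    push_cast; ring
  have hw0 : emb cp / emb c₃ ^ 2 ≠ 0 :=
    div_ne_zero ((map_ne_zero emb).mpr hcp0) (pow_ne_zero 2 ((map_ne_zero emb).mpr hc₃0))
  have hTv : ∀ h : H, (show AlgebraicClosure K ≃ₐ[K] AlgebraicClosure K from T (h : _)) vB = vB := fun h ↦
    JZero.apply_eq_self_of_cubeRoot hω _ hw0 hw3.symm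
      (by rw [map_div₀, map_pow, hT, hT, ((hH _).mp h.2).1, ((hH _).mp h.2).2])
  have hρT : ∀ (h : H) (P : geomPoints ((cubeSumCurve 9).baseChange K)), ρ (T (h : _)) P = P := fun h P ↦
    JZero.rho_apply_of_apply_eq hvB hρ (hTv h) P
  -- ### `T h • P₁ = κ⁻¹ ι_pt (h y₁)`; hence `T (h s) • P₁ = T h • P₁`
  have hTP : ∀ h : H, T (h : _) • P₁ =
      κ.symm (ιpt (pointGalHom (⟨0, 0, 1, 0, -1⟩ : WeierstrassCurve ℚ) (ringClassField K ι (9 * p))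
        ((h : _ ≃ₐ[K] _).restrictScalars ℚ) y₁)) := by
    intro h
    have hcomp : ∀ x : ringClassField K ι (9 * p),
        (show AlgebraicClosure K ≃ₐ[K] AlgebraicClosure K from T (h : _)) (emb x) =
          emb ((((h : ringClassField K ι (9 * p) ≃ₐ[K] ringClassField K ι (9 * p)).restrictScalars ℚ :
            ringClassField K ι (9 * p) ≃ₐ[ℚ] ringClassField K ι (9 * p)) :
              ringClassField K ι (9 * p) →+* ringClassField K ι (9 * p)) x) := fun x ↦ hT (h : _) x
    rw [hP₁, ← hκs, smul_embPoints_eq_of_comp (⟨0, 0, 1, 0, -1⟩ : WeierstrassCurve ℚ) emb ιpt hιpt (T (h : _))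
      _ hcomp, map_toRatAlgHom_eq_pointGalHom]
    rfl
  have hTs : ∀ h : H, T ((h * s : H) : _) • P₁ = T (h : _) • P₁ := by
    intro h
    rw [hTP, hTP]
    have e : ((h * s : H) : ringClassField K ι (9 * p) ≃ₐ[K] ringClassField K ι (9 * p)).restrictScalars ℚ =
        ((h : H) : _ ≃ₐ[K] _).restrictScalars ℚ * ((s : H) : _ ≃ₐ[K] _).restrictScalars ℚ := by
      ext x; rfl
    rw [e, map_mul]
    change κ.symm (ιpt (pointGalHom _ _ _ (pointGalHom _ _ _ y₁))) = _
    rw [hsy]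
  -- ### full = 2 • half
  set g : ((ringClassField K ι (9 * p) ≃ₐ[K] ringClassField K ι (9 * p)) ⧸ H) → H →
      geomPoints ((cubeSumCurve 9).baseChange K) := fun q h ↦ ρ (t (q, h)) (t (q, h) • P₁) with hg
  have hgs : ∀ q (h : H), g q (h * s) = g q h := by
    intro q h
    simp only [hg, ht', JZero.rho_mul_apply_of_omega hω hvB hvB3 hρ, mul_smul, hρT, hTs]
  have hfh : (∑ i, ρ (t i) (t i • P₁)) =
      2 • ∑ i : ((ringClassField K ι (9 * p) ≃ₐ[K] ringClassField K ι (9 * p)) ⧸ H) × H',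
        ρ (t (i.1, (i.2 : H))) (t (i.1, (i.2 : H)) • P₁) := by
    rw [Fintype.sum_prod_type, Fintype.sum_prod_type, Finset.smul_sum]
    refine Finset.sum_congr rfl fun q _ ↦ ?_
    have e1 : ∑ h : H, ρ (t (q, h)) (t (q, h) • P₁) = ∑ h : H, g q h := rfl
    have e2 : ∑ h : H', ρ (t (q, (h : H))) (t (q, (h : H)) • P₁) = ∑ h ∈ H', g q h :=
      Finset.sum_coe_sort H' (g q)
    rw [e1, e2]
    exact sum_eq_two_nsmul_sum_of_mul_eq s H' hH' (g q) (hgs q)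
  -- ### the half sum lies in `E₉(K̄)^{N₀}`, so `ψ_B` of it lies in `A₂`
  haveI hN₀n : N₀.Normal := by
    have hK := JZero.isImaginaryQuadratic_of_sq_add_self_add_one hω h2
    have hm0 : 9 * p ≠ 0 := mul_ne_zero (by norm_num) hp0
    haveI := (finiteDimensional_and_isGalois_ringClassField hK ι hm0).2
    exact normal_of_mem_iff emb hemb N₀ hN₀
  have hP₁N : ∀ n ∈ N₀, n • P₁ = P₁ := fun n hn ↦ by
    rw [hP₁, ← hκs, smul_embPoints_eq_self (⟨0, 0, 1, 0, -1⟩ : WeierstrassCurve ℚ) emb ιpt hιpt n ((hN₀ n).mp hn)]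
  have hterm : ∀ g₀ : absoluteGaloisGroup K,
      ρ g₀ (g₀ • P₁) ∈ FixedPoints.addSubgroup N₀ (geomPoints ((cubeSumCurve 9).baseChange K)) := by
    intro g₀
    rw [JZero.mem_fixedPoints_iff]
    intro n hn
    rw [hρcomm, ← mul_smul, show n * g₀ = g₀ * (g₀⁻¹ * n * g₀) by group, mul_smul,
      hP₁N _ (hN₀n.conj_mem' n hn g₀)]
  have hhalfmem : ψB (∑ i : ((ringClassField K ι (9 * p) ≃ₐ[K] ringClassField K ι (9 * p)) ⧸ H) × H',
        ρ (t (i.1, (i.2 : H))) (t (i.1, (i.2 : H)) • P₁)) ∈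
      (FixedPoints.addSubgroup N₀ (geomPoints ((cubeSumCurve 9).baseChange K))).map ψB.toAddMonoidHom :=
    AddSubgroup.mem_map.mpr ⟨_, AddSubgroup.sum_mem _ fun i _ ↦ hterm _, rfl⟩
  -- ### conclude: `2 • (ψ_B(half) − ι([𝒢₀:H] • Y′ − T₀)) = 0`
  set c : ℤ := (Fintype.card ((ringClassField K ι (9 * p) ≃ₐ[K] ringClassField K ι (9 * p)) ⧸ H) : ℤ) with hc
  have h3T₀ : (3 : ℕ) • T₀ = 0 := by rw [← natCast_zsmul]; exact_mod_cast hT₀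
  have key : c • Y₁ + T₀ = (2 : ℕ) • (c • Y' + -T₀) := by
    rw [← h2Y', ← sub_eq_zero, ← h3T₀]
    module
  refine ⟨-T₀, by rw [smul_neg, hT₀, _root_.neg_zero], ?_⟩
  rw [← sub_eq_zero]
  refine eq_zero_of_two_nsmul_eq_zero_of_mem hω h2 ι hp2 hvB hvB3 hρ hlawB emb hemb N₀ hN₀
    (sub_mem hhalfmem (toGeomPoints_mem_map_fixedPoints hψB N₀ hNv _)) ?_
  rw [smul_sub, ← map_nsmul ψB, ← hfh, hfull, ← map_nsmul, key, sub_self]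

end Summit.BirchSwinnertonDyer.BirchSwinnertonDyer.Theorems.SylvesterTwoCMHalf

end
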